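import Literature.NumberTheory.Automorphic.LocalLanglandsGL
import Literature.NumberTheory.Automorphic.LocalLanglandsGLProofs
import Literature.NumberTheory.Automorphic.GKModulesAdmissible
import Summits.Langlands.Statement

/-!
# Disproof work file — crux `ReciprocityUpToIrreducibilityR` (stmt-Langlands-17925, route
`IrreducibilityBySelfDuality`, crux disprover cycle 1, 2026-08-17)

R := `∀ F, Nonempty (ReciprocityData F) ∧ ∀ Rec n, 0 < n → ∀ hcpt, (A′) ∧ (B)` — the REVISED summit
minus irreducibility / uniqueness in (A).  Verdict of this cycle: **NO KILL**; R is a projection of the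
audited summit (`R_of_langlands`), so any `¬ R` would refute `Langlands` itself.

## Findings (index; details in the docstrings below)

* §1 Structure.  `R_of_langlands : Langlands → R` (restates-target by design); `R → E` (the `∃ Rec`
  form 14328) and `R → ∀ F, Nonempty (ReciprocityData F)`; `IsEmpty (ReciprocityData F) → ¬ R`
  (the fail-safe non-vacuity conjunct is the only clause a typing defect could make FALSE; not
  refutable in tree: it unfolds to the named facts `LocalLanglandsDatum.nonempty`-at-canonical-data).
* §2 THE `∀ Rec` EXPOSURE, made kernel-precise (the one feature distinguishing R from E):
  reciprocity data are NOT rigid.  From ANY `L : LocalLanglandsDatum F` and any quasi-character `η`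
  with `η² = 1` we BUILD `swapDatum L η` with the same (canonical) Artin datum and `ε`-system and, for
  `η ≠ 1`, a DIFFERENT `recGL 2` (the classes `[χ ∘ det]` of `GL₂(F)` go to `rec₂([(χη) ∘ det])`);
  all six clauses of `IsLocalLanglandsGL` are re-verified (bijective: an involution; (ii) untouched;
  (iii-L/ε) only constrain generic classes, which are fixed — `χ ∘ det` is not generic; (iv) the
  relabelling commutes with twists; (v) `η(a²) = 1`).  `signQuasiChar` (the unramified sign character
  `(-1)^{v(x)}`) makes it hypothesis-free: `exists_localLanglandsDatum_recGL_two_ne'`,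
  `exists_reciprocityData_recGL_two_ne'` (every `𝓡 : ReciprocityData K` has a PINNED sibling with
  `(𝓡'.llc v).recGL 2 ≠ (𝓡.llc v).recGL 2`).  CONSEQUENCES: `RecRigidityAllClasses` (= the
  conclusion of the lead's `stub_recRigidityLAlg` for every irreducible smooth `πv`, its hypothesis
  `HasLocalComponentAt` deleted) is FALSE given one datum — `not_recRigidityAllClasses_of_nonempty`,
  `stub_recRigidityLAlg_false_without_hasLocalComponentAt`, and `not_recRigidityAllClasses_of_R`
  (R refutes it through its own non-vacuity conjunct).  The relabelling never meets a generic class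
  (`swap_mk_of_isGeneric`), hence never a local component of a cuspidal `π`
  (`CuspidalAutomorphicRepData.exists_isGeneric_of_hasLocalComponentAt`): it does NOT refute R.
  LANDED / FILED: `Theorems/ReciprocityUpToIrreducibilityR/Negative/DetClassRelabelling.lean`
  (p146728, ACCEPTED, commit 437282d9d30f) + `…/Negative/ReciprocityDataNotRigid.lean` (p146812,
  submitted; imports part 1) — namespace `…Theorems.ReciprocityUpToIrreducibilityR.Negative`,
  importable by ideators / planners / the lead.
* §3 Why every hypothesis-drop resists (prose + the precise missing theorem, no sorries):
  `IsLAlgebraic`, `IsIrreducible`/`IsGeometricFramed` in (B), `0 < n` — each mutation is false in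
  print but its refutation needs a NON-EXISTENCE theorem for Galois characters / cusp forms that the
  tree cannot state a witness for (no Kronecker–Weber, no cuspidal datum on `GL_n`, `n ≥ 2`, no
  semisimplification), and the `v ∣ ℓ` clauses are relative to the `Classical.epsilon`-pinned
  Fontaine datum (decidable only for unramified-at-ℓ instances, F8).
* §4 Targets (lead stubs of line `Sketch`): `stub_recRigidityLAlg` — true in print, hypothesis
  load-bearing (§2); `stub_exists_localEpsilonSystem_forall_isCanonical`, `stub_localLanglands_gl`
  — printed theorems (Deligne 1973 / Harris–Taylor + Henniart), the second over-general in `d`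
  (harmless: instantiated at the canonical pair only); `stub_E` = 14328 (open problem).
* WHY R RESISTS (summary for the lead).  (1) R is a projection of the audited summit.  (2) Its only
  extra content over E, `∀ Rec`, enters `Corresponds` solely through `(Rec.llc v).recGL n [πv]` at a
  LOCAL COMPONENT `πv` of a cuspidal `π`; such `πv` are generic (in tree) and the non-rigidity of §2
  lives exactly on the non-generic classes; exercising it against R would need a cuspidal `π` on
  `GL₂` with a one-dimensional local component — none exists (and none is constructible: no cuspidal
  datum on `GL_n`, `n ≥ 2`, is in tree).  (3) Above rank 1 nothing on either side of `Corresponds` is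
  constructible, and at rank 1 the pins make `∀ Rec` free (rattack: `recGL_one_eq_of_reciprocityData`)
  and the normalisations are mutually consistent (`π = 1 ↦ ρ = 1`).  (4) The fail-safe conjunct
  `Nonempty (ReciprocityData F)` could only be false through an unsatisfiable interface, which would
  contradict named facts the tree cannot decide.
-/

noncomputable section

open scoped MatrixGroups NumberField WithZero
open NumberField IsDedekindDomain Filter
open Literature.NumberTheory.Automorphic Literature.NumberTheory.GaloisRepresentations
open Literature.NumberTheory.GaloisRepresentations.IsNonarchimedeanLocalField ValuativeRel
open Summit.Langlands

namespace Summit.Langlands.Langlands.Cruxes.ReciprocityUpToIrreducibilityR.Disproof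

set_option linter.dupNamespace false

/-! ## §0 Verbatim copies of the route decls (the farm olean of the Theses module predates rev 25) -/

/-- VERBATIM copy of `Summit.Langlands.Langlands.Theses.IrreducibilityBySelfDuality.ReciprocityUpToIrreducibilityR`
(item stmt-Langlands-17925, route file rev 27; character-identical body). -/
def R : Prop :=
  ∀ (F : Type) [Field F] [NumberField F], Nonempty (ReciprocityData F) ∧ ∀ (Rec : ReciprocityData F) (n : ℕ), 0 < n → ∀ hcpt : Literature.NumberTheory.Automorphic.isCompact_glFiniteIntegralLevel n F, (∀ π : Literature.NumberTheory.Automorphic.CuspidalAutomorphicRepData n F hcpt, π.1.IsLAlgebraic → ∀ (ℓ : ℕ) [Fact ℓ.Prime] (ι : PadicAlgCl ℓ ≃+* ℂ), ∃ ρ : Literature.NumberTheory.GaloisRepresentations.FramedGaloisRep F (PadicAlgCl ℓ) n, IsGeometricFramed Rec ρ ∧ Corresponds Rec ι π.1 ρ) ∧ GaloisToAutomorphic n Rec hcpt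

/-- VERBATIM copy of the support decl `…IrreducibilityBySelfDuality.ReciprocityUpToIrreducibility`
(item stmt-Langlands-14328, the `∃ Rec` form E). -/
def E : Prop :=
  ∀ (F : Type) [Field F] [NumberField F], ∃ Rec : ReciprocityData F, ∀ n : ℕ, 0 < n → ∀ hcpt : Literature.NumberTheory.Automorphic.isCompact_glFiniteIntegralLevel n F, (∀ π : Literature.NumberTheory.Automorphic.CuspidalAutomorphicRepData n F hcpt, π.1.IsLAlgebraic → ∀ (ℓ : ℕ) [Fact ℓ.Prime] (ι : PadicAlgCl ℓ ≃+* ℂ), ∃ ρ : Literature.NumberTheory.GaloisRepresentations.FramedGaloisRep F (PadicAlgCl ℓ) n, IsGeometricFramed Rec ρ ∧ Corresponds Rec ι π.1 ρ) ∧ GaloisToAutomorphic n Rec hcpt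

/-! ## §1 Structure: R is a projection of the summit; what R hands back -/

/-- **Restates-target (by design).** The crux is implied by the summit: drop irreducibility and
uniqueness from clause (A).  Consequently any refutation of R refutes `Langlands`. [folklore] -/
theorem R_of_langlands (h : _root_.Langlands) : R := by
  intro F _ _
  refine ⟨(h F).1, fun Rec n hn hcpt => ?_⟩
  obtain ⟨hA, hB⟩ := (h F).2 Rec n hn hcpt
  refine ⟨fun π hπ ℓ _ ι => ?_, hB⟩
  obtain ⟨ρ, -, hgeo, hcorr, -⟩ := hA π hπ ℓ ι
  exact ⟨ρ, hgeo, hcorr⟩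

/-- R hands back the `∃ Rec` form E (14328) — so every negative lemma recorded for 14328
(`Theorems/ReciprocityUpToIrreducibility/Negative/*`) transfers verbatim. [folklore] -/
theorem E_of_R (h : R) : E := by
  intro F _ _
  obtain ⟨⟨Rec⟩, h'⟩ := h F
  exact ⟨Rec, fun n hn hcpt => h' Rec n hn hcpt⟩

/-- R hands back its non-vacuity conjunct. [folklore] -/
theorem nonempty_of_R (h : R) (F : Type) [Field F] [NumberField F] : Nonempty (ReciprocityData F) :=
  (h F).1

/-- **The fail-safe direction.** Were the pinned interface `ReciprocityData F` EMPTY for one number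
field (e.g. `IsLocalLanglandsGL` unsatisfiable against the canonical Artin map, or no `ε`-system
with canonical Artin data at every finite extension), R would be FALSE — for the wrong reason.  Not
refutable in tree: emptiness would contradict the named facts `LocalLanglandsDatum.nonempty` /
`localLanglands_gl` / `nonempty_localEpsilonSystem` read at canonical data (Harris–Taylor Thm A,
Deligne 1973), none of which the tree can decide. [folklore] -/
theorem not_R_of_isEmpty (F : Type) [Field F] [NumberField F] (h : IsEmpty (ReciprocityData F)) :
    ¬ R :=
  fun hR => h.false (nonempty_of_R hR F).some

/-! ## §2 The `∀ Rec` exposure, kernel-precise: reciprocity data are NOT rigid on all classes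

(Identical mathematics is LANDED / filed as the Negative lemmas
`Theorems/ReciprocityUpToIrreducibilityR/Negative/DetClassRelabelling.lean` (p146728, accepted) +
`…/Negative/ReciprocityDataNotRigid.lean` (p146812) — namespace
`…Theorems.ReciprocityUpToIrreducibilityR.Negative`; it is inlined here so that this work file
elaborates on its own while the farm rebuilds.)
-/

/-! ### Bookkeeping on bundled irreducible smooth representations -/

section SmoothIrrepLemmas

variable {G : Type*} [Group G] [TopologicalSpace G]

/-- Two bundled irreducible smooth representations on the same space with equal actions are equal
(the remaining fields are propositions). [folklore] -/
theorem smoothIrrep_mk_eq_mk {V : Type} [AddCommGroup V] [Module ℂ V]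
    {ρ ρ' : Representation ℂ G V} (h : ρ = ρ') (p : ρ.IsIrreducible) (q : ρ.IsSmooth)
    (p' : ρ'.IsIrreducible) (q' : ρ'.IsSmooth) :
    (⟨V, ρ, p, q⟩ : SmoothIrrep G) = ⟨V, ρ', p', q'⟩ := by
  subst h; rfl

variable [SeparatelyContinuousMul G]

/-- The kernel of a product of characters with open kernels is open. [folklore] -/
theorem isOpen_ker_mul {c c' : G →* ℂˣ} (hc : IsOpen (c.ker : Set G))
    (hc' : IsOpen (c'.ker : Set G)) : IsOpen ((c * c').ker : Set G) := by
  have h : IsOpen ((c.ker ⊓ c'.ker : Subgroup G) : Set G) := by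
    rw [Subgroup.coe_inf]; exact hc.inter hc'
  refine Subgroup.isOpen_mono ?_ h
  intro g hg
  simp only [Subgroup.mem_inf, MonoidHom.mem_ker] at hg
  rw [MonoidHom.mem_ker, MonoidHom.mul_apply, hg.1, hg.2, one_mul]

/-- Iterated twists: `(π ⊗ c) ⊗ c' = π ⊗ (c c')` as bundled representations. [folklore] -/
theorem twist_twist (π : SmoothIrrep G) (c c' : G →* ℂˣ) (hc : IsOpen (c.ker : Set G))
    (hc' : IsOpen (c'.ker : Set G)) :
    (π.twist c hc).twist c' hc' = π.twist (c * c') (isOpen_ker_mul hc hc') :=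
  smoothIrrep_mk_eq_mk (Representation.twist_twist π.ρ c c') _ _ _ _

/-- Twisting by the trivial character does nothing. [folklore] -/
theorem twist_one (π : SmoothIrrep G) (h : IsOpen ((1 : G →* ℂˣ).ker : Set G)) :
    π.twist 1 h = π :=
  smoothIrrep_mk_eq_mk (Representation.twist_one π.ρ) _ _ _ _

/-- Twists by characters commute. [folklore] -/
theorem twist_comm (π : SmoothIrrep G) (c c' : G →* ℂˣ) (hc : IsOpen (c.ker : Set G))
    (hc' : IsOpen (c'.ker : Set G)) :
    (π.twist c hc).twist c' hc' = (π.twist c' hc').twist c hc := by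
  rw [twist_twist, twist_twist]
  exact smoothIrrep_mk_eq_mk (by rw [show c * c' = c' * c from MonoidHom.ext fun _ => mul_comm _ _])
    _ _ _ _

/-- Twisting twice by a character of order `≤ 2` does nothing. [folklore] -/
theorem twist_twist_of_mul_self (π : SmoothIrrep G) {c : G →* ℂˣ} (hc : IsOpen (c.ker : Set G))
    (h : c * c = 1) : (π.twist c hc).twist c hc = π := by
  have h1 : IsOpen ((1 : G →* ℂˣ).ker : Set G) := h ▸ isOpen_ker_mul hc hc
  rw [twist_twist]
  have h2 : π.twist (c * c) (isOpen_ker_mul hc hc) = π.twist 1 h1 :=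
    smoothIrrep_mk_eq_mk (by rw [h]) _ _ _ _
  rw [h2, twist_one]

end SmoothIrrepLemmas

/-! ### One-dimensional classes `χ ∘ det` of `GL_n(F)` -/

section DetChar

variable {F : Type} [Field F] [ValuativeRel F] [TopologicalSpace F] [IsNonarchimedeanLocalField F]

omit [ValuativeRel F] [IsNonarchimedeanLocalField F] in
/-- The one-dimensional representation `g ↦ χ(det g)` of `GL_n(F)` on `ℂ`. [folklore] -/
def detCharRep (n : ℕ) (χ : QuasiChar F) : Representation ℂ (GL (Fin n) F) ℂ where
  toFun g := ((χ (Matrix.GeneralLinearGroup.det g) : ℂˣ) : ℂ) • LinearMap.id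
  map_one' := by ext; simp
  map_mul' g h := by ext; simp [mul_comm]

omit [ValuativeRel F] [IsNonarchimedeanLocalField F] in
@[simp] theorem detCharRep_apply (n : ℕ) (χ : QuasiChar F) (g : GL (Fin n) F) (z : ℂ) :
    detCharRep n χ g z = ((χ (Matrix.GeneralLinearGroup.det g) : ℂˣ) : ℂ) * z := rfl

/-- The irreducible smooth representation `χ ∘ det` of `GL_n(F)` attached to a quasi-character
(smooth because quasi-characters have open kernel, `isOpen_ker_quasiChar_holds`). [folklore] -/
def detCharIrrep (n : ℕ) (χ : QuasiChar F) : SmoothIrrep (GL (Fin n) F) where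
  V := ℂ
  ρ := detCharRep n χ
  isIrreducible := isIrreducible_of_finrank_eq_one' _ (Module.finrank_self ℂ)
  isSmooth := by
    intro v
    refine Subgroup.isOpen_mono ?_ (isOpen_ker_charDet n (isOpen_ker_quasiChar_holds χ))
    intro g hg
    rw [MonoidHom.mem_ker, charDet_apply] at hg
    rw [Representation.mem_stabilizerSubgroup]
    change ((χ (Matrix.GeneralLinearGroup.det g) : ℂˣ) : ℂ) * v = v
    rw [hg, Units.val_one, one_mul]

/-- `π` **acts through `χ ∘ det`**: `π(g) v = χ(det g) v`. [folklore] -/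
def ActsByDet {n : ℕ} (π : SmoothIrrep (GL (Fin n) F)) (χ : QuasiChar F) : Prop :=
  ∀ (g : GL (Fin n) F) (v : π.V), π.ρ g v = ((χ (Matrix.GeneralLinearGroup.det g) : ℂˣ) : ℂ) • v

theorem actsByDet_detCharIrrep (n : ℕ) (χ : QuasiChar F) : ActsByDet (detCharIrrep n χ) χ :=
  fun _ _ => rfl

omit [ValuativeRel F] [IsNonarchimedeanLocalField F] in
/-- `ActsByDet` transports along isomorphisms of representations. [folklore] -/
theorem ActsByDet.transport {n : ℕ} {π π' : SmoothIrrep (GL (Fin n) F)} (e : π.ρ.Equiv π'.ρ)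
    {χ : QuasiChar F} (h : ActsByDet π χ) : ActsByDet π' χ := by
  intro g v'
  obtain ⟨v, rfl⟩ := e.toLinearEquiv.surjective v'
  have h1 := e.toIntertwiningMap.isIntertwining π.ρ π'.ρ g v
  rw [Representation.Equiv.coe_toIntertwiningMap] at h1
  rw [Representation.Equiv.toLinearEquiv_apply, Representation.Equiv.coe_toIntertwiningMap, ← h1,
    h g v, map_smul]

omit [ValuativeRel F] [IsNonarchimedeanLocalField F] in
theorem quasiChar_mul_apply (χ η : QuasiChar F) (x : Fˣ) : (χ * η) x = χ x * η x := rfl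

omit [ValuativeRel F] [IsNonarchimedeanLocalField F] in
theorem quasiChar_inv_apply (η : QuasiChar F) (x : Fˣ) : η⁻¹ x = (η x)⁻¹ := rfl

/-- Twisting `χ ∘ det` by `η ∘ det` gives `(χη) ∘ det`. [folklore] -/
theorem ActsByDet.twist {n : ℕ} {π : SmoothIrrep (GL (Fin n) F)} {χ : QuasiChar F}
    (h : ActsByDet π χ) (η : QuasiChar F) (hη : IsOpen ((charDet n η).ker : Set (GL (Fin n) F))) :
    ActsByDet (π.twist (charDet n η) hη) (χ * η) := by
  change ∀ (g : GL (Fin n) F) (v : π.V), ((charDet n η g : ℂˣ) : ℂ) • π.ρ g v =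
    (((χ * η) (Matrix.GeneralLinearGroup.det g) : ℂˣ) : ℂ) • v
  intro g v
  rw [h g v, charDet_apply, smul_smul, quasiChar_mul_apply, Units.val_mul, mul_comm]

/-- Conversely, if a twist by `η ∘ det` acts through `χ ∘ det` then `π` acts through
`(χ η⁻¹) ∘ det`. [folklore] -/
theorem ActsByDet.of_twist {n : ℕ} {π : SmoothIrrep (GL (Fin n) F)} {χ : QuasiChar F}
    (η : QuasiChar F) (hη : IsOpen ((charDet n η).ker : Set (GL (Fin n) F)))
    (h : ActsByDet (π.twist (charDet n η) hη) χ) : ActsByDet π (χ * η⁻¹) := by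
  intro g v
  have h1 : ((charDet n η g : ℂˣ) : ℂ) • π.ρ g v =
      ((χ (Matrix.GeneralLinearGroup.det g) : ℂˣ) : ℂ) • v := h g v
  rw [charDet_apply] at h1
  have ha : ((η (Matrix.GeneralLinearGroup.det g) : ℂˣ) : ℂ) ≠ 0 := Units.ne_zero _
  calc π.ρ g v = ((η (Matrix.GeneralLinearGroup.det g) : ℂˣ) : ℂ)⁻¹ •
        (((η (Matrix.GeneralLinearGroup.det g) : ℂˣ) : ℂ) • π.ρ g v) := by
          rw [smul_smul, inv_mul_cancel₀ ha, one_smul]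
    _ = (((χ * η⁻¹) (Matrix.GeneralLinearGroup.det g) : ℂˣ) : ℂ) • v := by
          rw [h1, smul_smul, quasiChar_mul_apply, quasiChar_inv_apply, Units.val_mul,
            Units.val_inv_eq_inv_val, mul_comm]

/-- A class of `Irr(GL_n(F))` **is a `det`-character class**: some (every) representative acts
through `χ ∘ det` for some quasi-character `χ`. [folklore] -/
def IsDetChar {n : ℕ} : IrrClass (GL (Fin n) F) → Prop :=
  IrrClass.liftProp (fun π => ∃ χ : QuasiChar F, ActsByDet π χ)
    (fun _ _ e h => h.elim fun χ hχ => ⟨χ, hχ.transport e⟩)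

omit [ValuativeRel F] [IsNonarchimedeanLocalField F] in
@[simp] theorem isDetChar_mk {n : ℕ} (π : SmoothIrrep (GL (Fin n) F)) :
    IsDetChar (IrrClass.mk π) ↔ ∃ χ : QuasiChar F, ActsByDet π χ := Iff.rfl

omit [ValuativeRel F] [TopologicalSpace F] [IsNonarchimedeanLocalField F] in
/-- `n(x) = (1 x; 0 1) ∈ U₂(F)`. [folklore] -/
theorem upperRightHom_mem (x : F) :
    (Matrix.GeneralLinearGroup.upperRightHom x : GL (Fin 2) F) ∈ upperUnitriangular (Fin 2) F := by
  rw [mem_upperUnitriangular_iff, Matrix.GeneralLinearGroup.upperRightHom_apply]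
  refine ⟨fun i j hij => ?_, fun i => ?_⟩
  · fin_cases i <;> fin_cases j <;> simp at hij ⊢
  · fin_cases i <;> simp

omit [ValuativeRel F] [TopologicalSpace F] [IsNonarchimedeanLocalField F] in
/-- `ψ_U(n(x)) = ψ(x)`. [folklore] -/
theorem whittakerCharFun_upperRightHom (ψ : AddChar F Circle) (x : F) :
    whittakerCharFun ψ ⟨_, upperRightHom_mem x⟩ = ((ψ x : Circle) : ℂ) := by
  rw [whittakerCharFun_apply, superdiagSum_def, Fin.sum_univ_two, Fin.sum_univ_two, Fin.sum_univ_two]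
  simp [Matrix.GeneralLinearGroup.upperRightHom_apply]

omit [ValuativeRel F] [IsNonarchimedeanLocalField F] in
/-- **One-dimensional classes of `GL₂(F)` are not generic** (for any additive character that is
not identically `1`): `U₂` acts trivially (`det u = 1`) while `ψ_U(n(x)) = ψ(x) ≠ 1`. [folklore] -/
theorem not_isGeneric_of_actsByDet {π : SmoothIrrep (GL (Fin 2) F)} {χ : QuasiChar F}
    (h : ActsByDet π χ) {ψ : AddChar F Circle} (hψ : ∃ x, ψ x ≠ 1) : ¬ IsGeneric π.ρ ψ := by
  refine not_isGeneric_of_upperUnitriangular_le_ker (fun u => ?_) ?_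
  · refine LinearMap.ext fun v => ?_
    rw [h, det_eq_one_of_mem_upperUnitriangular u.2, map_one, Units.val_one, one_smul,
      Module.End.one_apply]
  · obtain ⟨x, hx⟩ := hψ
    refine ⟨⟨_, upperRightHom_mem x⟩, ?_⟩
    rw [whittakerCharFun_upperRightHom]
    exact fun h' => hx (Circle.coe_inj.1 (h'.trans Circle.coe_one.symm))

end DetChar

/-! ### The relabelling: twist the `det`-character classes of `GL₂(F)` by a fixed `η` -/

section Swap

variable {F : Type} [Field F] [ValuativeRel F] [TopologicalSpace F] [IsNonarchimedeanLocalField F]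
  (η : QuasiChar F)

theorem isOpen_ker_charDet_quasiChar (n : ℕ) : IsOpen ((charDet n η).ker : Set (GL (Fin n) F)) :=
  isOpen_ker_charDet n (isOpen_ker_quasiChar_holds η)

open Classical in
/-- On `Irr(GL₂(F))`: twist the `det`-character classes by `η ∘ det`, fix every other class. -/
def swapClass (c : IrrClass (GL (Fin 2) F)) : IrrClass (GL (Fin 2) F) :=
  if IsDetChar c then IrrClass.twist (charDet 2 η) (isOpen_ker_charDet_quasiChar η 2) c else c

/-- The relabelling in all ranks: `swapClass η` in rank `2`, the identity elsewhere. -/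
def swap : (n : ℕ) → IrrClass (GL (Fin n) F) → IrrClass (GL (Fin n) F)
  | 2 => swapClass η
  | _ => id

theorem swap_two : swap η 2 = swapClass η := rfl

theorem swap_of_ne_two {n : ℕ} (hn : n ≠ 2) : swap η n = id := by
  match n, hn with
  | 0, _ => rfl
  | 1, _ => rfl
  | 2, h => exact absurd rfl h
  | n + 3, _ => rfl

theorem swapClass_mk_of_actsByDet {π : SmoothIrrep (GL (Fin 2) F)} {χ : QuasiChar F}
    (h : ActsByDet π χ) :
    swapClass η (IrrClass.mk π) = IrrClass.mk (π.twist (charDet 2 η) (isOpen_ker_charDet_quasiChar η 2)) :=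
  if_pos ⟨χ, h⟩

theorem swapClass_of_not {c : IrrClass (GL (Fin 2) F)} (h : ¬ IsDetChar c) : swapClass η c = c :=
  if_neg h

/-- `swapClass η` fixes every generic class. [folklore] -/
theorem swapClass_mk_of_isGeneric (π : SmoothIrrep (GL (Fin 2) F)) {ψ : AddChar F Circle}
    (hψ : ∃ x, ψ x ≠ 1) (hg : IsGeneric π.ρ ψ) : swapClass η (IrrClass.mk π) = IrrClass.mk π :=
  swapClass_of_not η fun ⟨_, h⟩ => not_isGeneric_of_actsByDet h hψ hg

/-- `swap η n` fixes every generic class, in every rank. [folklore] -/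
theorem swap_mk_of_isGeneric {n : ℕ} (π : SmoothIrrep (GL (Fin n) F)) {ψ : AddChar F Circle}
    (hψ : ∃ x, ψ x ≠ 1) (hg : IsGeneric π.ρ ψ) : swap η n (IrrClass.mk π) = IrrClass.mk π := by
  rcases eq_or_ne n 2 with rfl | hn
  · exact swapClass_mk_of_isGeneric η π hψ hg
  · rw [swap_of_ne_two η hn, id]

/-- `swapClass η` commutes with twisting by any `χ' ∘ det`. [folklore] -/
theorem swapClass_twist (χ' : QuasiChar F) (hχ' : IsOpen ((charDet 2 χ').ker : Set (GL (Fin 2) F)))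
    (c : IrrClass (GL (Fin 2) F)) :
    swapClass η (IrrClass.twist (charDet 2 χ') hχ' c) =
      IrrClass.twist (charDet 2 χ') hχ' (swapClass η c) := by
  induction c using IrrClass.ind with
  | h π =>
    rw [IrrClass.twist_mk]
    by_cases hd : ∃ χ : QuasiChar F, ActsByDet π χ
    · obtain ⟨χ, hχ⟩ := hd
      rw [swapClass_mk_of_actsByDet η (hχ.twist χ' hχ'), swapClass_mk_of_actsByDet η hχ,
        IrrClass.twist_mk, twist_comm]
    · have hd' : ¬ IsDetChar (IrrClass.mk (π.twist (charDet 2 χ') hχ')) :=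
        fun ⟨χ, hχ⟩ => hd ⟨_, hχ.of_twist χ' hχ'⟩
      rw [swapClass_of_not η hd', swapClass_of_not η (c := IrrClass.mk π) hd, IrrClass.twist_mk]

/-- `swap η n` commutes with twisting by any `χ' ∘ det`, in every rank. [folklore] -/
theorem swap_twist {n : ℕ} (χ' : QuasiChar F) (hχ' : IsOpen ((charDet n χ').ker : Set (GL (Fin n) F)))
    (c : IrrClass (GL (Fin n) F)) :
    swap η n (IrrClass.twist (charDet n χ') hχ' c) = IrrClass.twist (charDet n χ') hχ' (swap η n c) := by
  rcases eq_or_ne n 2 with rfl | hn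
  · exact swapClass_twist η χ' hχ' c
  · rw [swap_of_ne_two η hn, id, id]

variable (hη2 : ∀ x, η x * η x = 1)
include hη2

omit [ValuativeRel F] [IsNonarchimedeanLocalField F] in
theorem charDet_mul_self_eq_one (n : ℕ) : charDet n η * charDet n η = 1 := by
  refine MonoidHom.ext fun g => ?_
  rw [MonoidHom.mul_apply, MonoidHom.one_apply, charDet_apply]
  exact hη2 _

/-- For `η² = 1`, `swapClass η` is an involution. [folklore] -/
theorem swapClass_swapClass (c : IrrClass (GL (Fin 2) F)) : swapClass η (swapClass η c) = c := by
  induction c using IrrClass.ind with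
  | h π =>
    by_cases hd : ∃ χ : QuasiChar F, ActsByDet π χ
    · obtain ⟨χ, hχ⟩ := hd
      rw [swapClass_mk_of_actsByDet η hχ, swapClass_mk_of_actsByDet η (hχ.twist η _),
        twist_twist_of_mul_self π _ (charDet_mul_self_eq_one η hη2 2)]
    · rw [swapClass_of_not η (c := IrrClass.mk π) hd, swapClass_of_not η (c := IrrClass.mk π) hd]

/-- For `η² = 1`, every `swap η n` is a bijection. [folklore] -/
theorem swap_bijective (n : ℕ) : Function.Bijective (swap η n) := by
  rcases eq_or_ne n 2 with rfl | hn
  · exact Function.Involutive.bijective (swapClass_swapClass η hη2)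
  · rw [swap_of_ne_two η hn]
    exact Function.bijective_id

end Swap

/-! ### A quasi-character of order two: the unramified sign character -/

section SignChar

variable (F : Type) [Field F] [ValuativeRel F] [TopologicalSpace F] [IsNonarchimedeanLocalField F]

/-- The sign `(-1)^{ord γ}` of an element of the value group (junk `1` at `γ = 0`). [folklore] -/
def valSign (γ : ValueGroupWithZero F) : ℂˣ :=
  (-1 : ℂˣ) ^ WithZero.log (_root_.IsNonarchimedeanLocalField.valueGroupWithZeroIsoInt F γ)

/-- **The unramified sign character** `x ↦ (-1)^{v(x)}` of `Fˣ`: a quasi-character of order two,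
non-trivial (it is `-1` on elements of odd valuation). [folklore] -/
def signQuasiChar : QuasiChar F where
  toFun x := valSign F (valuation F (x : F))
  map_one' := by simp [valSign]
  map_mul' x y := by
    simp only [valSign, Units.val_mul, map_mul]
    rw [WithZero.log_mul, zpow_add]
    · simp
    · simp
  continuous_toFun :=
    ((isLocallyConstant_valuation_units (F := F)).comp (valSign F)).continuous

theorem signQuasiChar_apply (x : Fˣ) :
    signQuasiChar F x = (-1 : ℂˣ) ^ WithZero.log
      (_root_.IsNonarchimedeanLocalField.valueGroupWithZeroIsoInt F (valuation F (x : F))) := rfl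

theorem signQuasiChar_mul_self (x : Fˣ) : signQuasiChar F x * signQuasiChar F x = 1 := by
  rw [signQuasiChar_apply, ← mul_zpow]
  have : (-1 : ℂˣ) * -1 = 1 := by ext; simp
  rw [this, one_zpow]

theorem exists_signQuasiChar_ne_one : ∃ x : Fˣ, signQuasiChar F x ≠ 1 := by
  set e := _root_.IsNonarchimedeanLocalField.valueGroupWithZeroIsoInt F
  obtain ⟨x, hx⟩ := ValuativeRel.valuation_surjective (e.symm (WithZero.exp (1 : ℤ)))
  have hx0 : x ≠ 0 := by
    intro h
    rw [h, map_zero] at hx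
    have h1 : e (e.symm (WithZero.exp (1 : ℤ))) = e 0 := by rw [← hx]
    rw [e.apply_symm_apply, map_zero] at h1
    exact WithZero.exp_ne_zero h1
  refine ⟨Units.mk0 x hx0, ?_⟩
  rw [signQuasiChar_apply, Units.val_mk0, hx]
  change (-1 : ℂˣ) ^ WithZero.log (e (e.symm (WithZero.exp (1 : ℤ)))) ≠ 1
  rw [e.apply_symm_apply, WithZero.log_exp, zpow_one]
  intro h
  have := congrArg (fun u : ℂˣ => (u : ℂ)) h
  norm_num at this

/-- **Every non-archimedean local field has a quasi-character of order two which is not trivial.**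
[folklore] -/
theorem exists_quasiChar_mul_self_eq_one_ne_one :
    ∃ η : QuasiChar F, (∀ x, η x * η x = 1) ∧ ∃ x, η x ≠ 1 :=
  ⟨signQuasiChar F, signQuasiChar_mul_self F, exists_signQuasiChar_ne_one F⟩

end SignChar

/-! ### The sibling datum and the non-uniqueness theorems -/

section Datum

variable {F : Type} [Field F] [ValuativeRel F] [TopologicalSpace F] [IsNonarchimedeanLocalField F]

omit [ValuativeRel F] [IsNonarchimedeanLocalField F] in
theorem exists_apply_ne_one_of_isContinuousNontrivial {ψ : AddChar F Circle}
    (h : ψ.IsContinuousNontrivial) : ∃ x, ψ x ≠ 1 :=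
  AddChar.ne_zero_iff.1 h.2

omit [ValuativeRel F] [TopologicalSpace F] [IsNonarchimedeanLocalField F] in
theorem exists_inv_apply_ne_one {ψ : AddChar F Circle} (h : ∃ x, ψ x ≠ 1) : ∃ x, ψ⁻¹ x ≠ 1 :=
  h.imp fun x hx => by rwa [AddChar.inv_apply', Ne, inv_eq_one]

/-- **The sibling datum.** From a local Langlands datum `L` and a quasi-character `η` with
`η² = 1`, the datum with the SAME threaded facts, Artin datum and `ε`-system whose `rec₂` is
precomposed with the relabelling `[χ ∘ det] ↦ [(χη) ∘ det]` of the one-dimensional classes of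
`GL₂(F)` (all other classes and ranks untouched).  All six clauses of `IsLocalLanglandsGL` are
re-verified: (i) the relabelling is an involution; (ii) rank `1` is untouched; (iii-L/ε) only
generic classes are constrained and those are fixed; (iv) the relabelling commutes with twists;
(v) central characters agree because `η(a²) = 1`.  This is the example of the "Uniqueness (why not
`∃!`)" paragraph of `LocalLanglandsGL`, carried out. [folklore] -/
def swapDatum (L : LocalLanglandsDatum F) (η : QuasiChar F) (hη2 : ∀ x, η x * η x = 1) :
    LocalLanglandsDatum F where
  hmul := L.hmul
  huniq := L.huniq
  hn := L.hn
  hex := L.hex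
  hns := L.hns
  hqc := L.hqc
  artin := L.artin
  eps := L.eps
  eps_artin := L.eps_artin
  recGL n c := L.recGL n (swap η n c)
  isLocalLanglands :=
    { bijective := fun n => (L.isLocalLanglands.bijective n).comp (swap_bijective η hη2 n)
      gl_one := fun χ π h => by
        show ((L.recGL 1 (IrrClass.mk π)).out.1).IsEquivalent _
        exact L.isLocalLanglands.gl_one χ π h
      lFactor_pairs := by
        intro m n hm hmn π π' ψ hψ hg hg' _ _ ν _ _ _ P
        have hx := exists_apply_ne_one_of_isContinuousNontrivial hψ
        rw [swap_mk_of_isGeneric η π hx hg, swap_mk_of_isGeneric η π' (exists_inv_apply_ne_one hx) hg']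
        exact L.isLocalLanglands.lFactor_pairs hm hmn π π' ψ hψ hg hg' ν P
      epsilon_pairs := by
        intro m n hm hmn π π' ψ hψ hg hg' _ _ μ _ hμ _ _ ν _ _ _ e a
        have hx := exists_apply_ne_one_of_isContinuousNontrivial hψ
        rw [swap_mk_of_isGeneric η π hx hg, swap_mk_of_isGeneric η π' (exists_inv_apply_ne_one hx) hg']
        exact L.isLocalLanglands.epsilon_pairs hm hmn π π' ψ hψ hg hg' μ hμ ν e a
      twist := by
        intro n χ' hχ' π
        rw [swap_twist]
        obtain ⟨π₁, hπ₁⟩ := IrrClass.mk_surjective (swap η n (IrrClass.mk π))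
        rw [← hπ₁, IrrClass.twist_mk]
        exact L.isLocalLanglands.twist n χ' hχ' π₁
      centralChar := by
        intro n π w c hc
        rcases eq_or_ne n 2 with rfl | hn
        · by_cases hd : ∃ χ : QuasiChar F, ActsByDet π χ
          · obtain ⟨χ, hχ⟩ := hd
            rw [swap_two, swapClass_mk_of_actsByDet η hχ]
            refine L.isLocalLanglands.centralChar 2 _ w c (LinearMap.ext fun v => ?_)
            have key : ((charDet 2 η (Matrix.GeneralLinearGroup.scalar (Fin 2) (L.artin.artin w)) :
                ℂˣ) : ℂ) = 1 := by
              rw [charDet_apply, Matrix.GeneralLinearGroup.det_scalar, Fintype.card_fin, pow_two,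
                map_mul, hη2, Units.val_one]
            change ((charDet 2 η (Matrix.GeneralLinearGroup.scalar (Fin 2) (L.artin.artin w)) :
                ℂˣ) : ℂ) • π.ρ (Matrix.GeneralLinearGroup.scalar (Fin 2) (L.artin.artin w)) v =
              (c • (LinearMap.id : π.V →ₗ[ℂ] π.V)) v
            rw [key, one_smul, ← hc]
          · rw [swap_two, swapClass_of_not η (c := IrrClass.mk π) hd]
            exact L.isLocalLanglands.centralChar 2 π w c hc
        · rw [swap_of_ne_two η hn, id]
          exact L.isLocalLanglands.centralChar n π w c hc }

variable (L : LocalLanglandsDatum F) (η : QuasiChar F) (hη2 : ∀ x, η x * η x = 1)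

/-- The sibling datum has the same Artin datum … -/
theorem swapDatum_artin : (swapDatum L η hη2).artin = L.artin := rfl

/-- … the same `ε`-system … -/
theorem swapDatum_eps : (swapDatum L η hη2).eps = L.eps := rfl

/-- … and the same `rec_n` in every rank `n ≠ 2`. [folklore] -/
theorem swapDatum_recGL_of_ne_two {n : ℕ} (hn : n ≠ 2) : (swapDatum L η hη2).recGL n = L.recGL n := by
  funext c
  show L.recGL n (swap η n c) = _
  rw [swap_of_ne_two η hn, id]

/-- `diag(x, 1) ∈ GL₂(F)`. [folklore] -/
def diagUnit (x : Fˣ) : GL (Fin 2) F :=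
  Matrix.GeneralLinearGroup.mkOfDetNeZero !![(x : F), 0; 0, 1] (by simp [Matrix.det_fin_two_of])

omit [ValuativeRel F] [TopologicalSpace F] [IsNonarchimedeanLocalField F] in
theorem det_diagUnit (x : Fˣ) : Matrix.GeneralLinearGroup.det (diagUnit x) = x := by
  ext
  rw [Matrix.GeneralLinearGroup.val_det_apply]
  change Matrix.det !![(x : F), 0; 0, 1] = x
  rw [Matrix.det_fin_two_of]
  ring

/-- **Non-uniqueness of local Langlands data, even pinned** (the `∀ Rec` exposure of the crux made
precise): for `η² = 1`, `η ≠ 1`, the sibling datum has a different `rec₂` — it moves the class of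
the trivial representation of `GL₂(F)` to the class of `η ∘ det`. [folklore] -/
theorem swapDatum_recGL_two_ne (hη1 : ∃ x, η x ≠ 1) : (swapDatum L η hη2).recGL 2 ≠ L.recGL 2 := by
  intro h
  have h1 : L.recGL 2 (swap η 2 (IrrClass.mk (detCharIrrep 2 (1 : QuasiChar F)))) =
      L.recGL 2 (IrrClass.mk (detCharIrrep 2 (1 : QuasiChar F))) := congrFun h _
  rw [swap_two, swapClass_mk_of_actsByDet η (actsByDet_detCharIrrep 2 1)] at h1
  obtain ⟨e⟩ := (IrrClass.mk_eq_mk_iff _ _).1 ((L.recGL_bijective 2).1 h1)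
  have hA : ActsByDet (detCharIrrep 2 (1 : QuasiChar F)) (1 * η) :=
    ((actsByDet_detCharIrrep 2 (1 : QuasiChar F)).twist η _).transport e
  obtain ⟨x, hx⟩ := hη1
  apply hx
  have h2 : (((1 * η) (Matrix.GeneralLinearGroup.det (diagUnit x)) : ℂˣ) : ℂ) * (1 : ℂ) =
      (((1 : QuasiChar F) (Matrix.GeneralLinearGroup.det (diagUnit x)) : ℂˣ) : ℂ) * (1 : ℂ) :=
    (hA (diagUnit x) (1 : ℂ)).symm
  have h4 : ∀ y : Fˣ, (1 : QuasiChar F) y = 1 := fun _ => rfl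
  rw [mul_one, mul_one, quasiChar_mul_apply, h4, one_mul, det_diagUnit, Units.val_one] at h2
  exact Units.val_eq_one.1 h2

include hη2 in
/-- Symmetric packaging: every local Langlands datum has a sibling with the same normalising pair
`(artin, eps)` and a different `rec₂`, as soon as `Fˣ` has a quasi-character of order two. -/
theorem exists_localLanglandsDatum_recGL_two_ne (hη1 : ∃ x, η x ≠ 1) :
    ∃ L' : LocalLanglandsDatum F, L'.artin = L.artin ∧ L'.eps = L.eps ∧ L'.recGL 2 ≠ L.recGL 2 :=
  ⟨swapDatum L η hη2, rfl, rfl, swapDatum_recGL_two_ne L η hη2 hη1⟩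

/-- **Local Langlands data are never unique as typed**: every `L : LocalLanglandsDatum F` has a
sibling with the same normalising pair `(artin, eps)` — hence passing the same canonical pins — and
a different `rec₂` (take `η` = the unramified sign character). [folklore] -/
theorem exists_localLanglandsDatum_recGL_two_ne' (L : LocalLanglandsDatum F) :
    ∃ L' : LocalLanglandsDatum F, L'.artin = L.artin ∧ L'.eps = L.eps ∧ L'.recGL 2 ≠ L.recGL 2 :=
  ⟨swapDatum L (signQuasiChar F) (signQuasiChar_mul_self F), rfl, rfl,
    swapDatum_recGL_two_ne L _ _ (exists_signQuasiChar_ne_one F)⟩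

end Datum

/-! ### Global reading: `ReciprocityData` is not rigid on all classes -/

section Global

open NumberField IsDedekindDomain

/-- **Every reciprocity datum has a pinned sibling with a different `rec₂` at `v`** (given a
quasi-character of order two of `K_vˣ`): the pins `llc_isCanonical` / `llc_eps_isCanonical` of
`ReciprocityData` see only the Artin data, which the sibling shares.  Hence "two reciprocity data
agree on EVERY class" — the conclusion of the line's `stub_recRigidityLAlg` with its hypothesis
`HasLocalComponentAt` dropped — is false; the crux quantifies `∀ Rec` over genuinely distinct data.
[folklore] -/
theorem exists_reciprocityData_recGL_two_ne {K : Type} [Field K] [NumberField K]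
    (𝓡 : ReciprocityData K) (v : HeightOneSpectrum (𝓞 K)) (η : QuasiChar (v.adicCompletion K))
    (hη2 : ∀ x, η x * η x = 1) (hη1 : ∃ x, η x ≠ 1) :
    ∃ 𝓡' : ReciprocityData K, (𝓡'.llc v).recGL 2 ≠ (𝓡.llc v).recGL 2 ∧
      (∀ w, (𝓡'.llc w).artin = (𝓡.llc w).artin ∧ (𝓡'.llc w).eps = (𝓡.llc w).eps) ∧
      ∀ w n, n ≠ 2 → (𝓡'.llc w).recGL n = (𝓡.llc w).recGL n := by
  classical
  let ηf : ∀ w : HeightOneSpectrum (𝓞 K), QuasiChar (w.adicCompletion K) :=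
    Function.update (fun w => 1) v η
  have hv : ηf v = η := by simp [ηf]
  have hηf : ∀ w x, ηf w x * ηf w x = 1 := by
    intro w x
    rcases eq_or_ne w v with rfl | hw
    · rw [hv]; exact hη2 x
    · have : ηf w = 1 := by simp [ηf, hw]
      rw [this]
      show (1 : ℂˣ) * 1 = 1
      exact one_mul 1
  refine ⟨⟨fun w => swapDatum (𝓡.llc w) (ηf w) (hηf w), fun w => 𝓡.llc_isCanonical w,
    fun w => 𝓡.llc_eps_isCanonical w⟩, ?_, fun w => ⟨rfl, rfl⟩,
    fun w n hn => swapDatum_recGL_of_ne_two _ _ (hηf w) hn⟩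
  have h1 : ∃ x, ηf v x ≠ 1 := by rw [hv]; exact hη1
  exact swapDatum_recGL_two_ne _ _ (hηf v) h1

/-- Hypothesis-free form: every reciprocity datum has, at every finite place, a pinned sibling with
a different `rec₂` there and the same `rec_n` everywhere else (`n ≠ 2`). [folklore] -/
theorem exists_reciprocityData_recGL_two_ne' {K : Type} [Field K] [NumberField K]
    (𝓡 : ReciprocityData K) (v : HeightOneSpectrum (𝓞 K)) :
    ∃ 𝓡' : ReciprocityData K, (𝓡'.llc v).recGL 2 ≠ (𝓡.llc v).recGL 2 ∧
      (∀ w, (𝓡'.llc w).artin = (𝓡.llc w).artin ∧ (𝓡'.llc w).eps = (𝓡.llc w).eps) ∧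
      ∀ w n, n ≠ 2 → (𝓡'.llc w).recGL n = (𝓡.llc w).recGL n :=
  exists_reciprocityData_recGL_two_ne 𝓡 v (signQuasiChar _) (signQuasiChar_mul_self _)
    (exists_signQuasiChar_ne_one _)

/-- Every number field has a finite place (`𝓞 K` is not a field). [folklore] -/
theorem nonempty_heightOneSpectrum (K : Type) [Field K] [NumberField K] :
    Nonempty (HeightOneSpectrum (𝓞 K)) := by
  obtain ⟨M, hM⟩ := Ideal.exists_maximal (𝓞 K)
  exact ⟨⟨M, hM.isPrime, Ring.ne_bot_of_isMaximal_of_not_isField hM (RingOfIntegers.not_isField K)⟩⟩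

/-- **The natural strengthening of the line's rigidity stub** — `stub_recRigidityLAlg` of
`Cruxes/ReciprocityUpToIrreducibilityR` (lead prover-line-stmt-Langlands-17925-0) with its hypothesis
`π.1.HasLocalComponentAt v πv.ρ` (and the then idle `π`, `hcpt`, `IsLAlgebraic` binders) DELETED:
"any two reciprocity data agree on EVERY irreducible smooth class at every place". -/
def RecRigidityAllClasses : Prop :=
  ∀ (K : Type) [Field K] [NumberField K] (Rec Rec' : ReciprocityData K) (n : ℕ), 0 < n →
    ∀ (v : HeightOneSpectrum (𝓞 K)) (πv : SmoothIrrep (GL (Fin n) (v.adicCompletion K))),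
      (Rec.llc v).recGL n (IrrClass.mk πv) = (Rec'.llc v).recGL n (IrrClass.mk πv)

/-- **`RecRigidityAllClasses` is false as soon as ONE reciprocity datum exists** (for any number
field) — in particular under the crux's own non-vacuity conjunct `Nonempty (ReciprocityData F)`:
the hypothesis `HasLocalComponentAt` of `stub_recRigidityLAlg` is load-bearing ("any proof must use
genericity of local components"). [folklore] -/
theorem not_recRigidityAllClasses_of_nonempty {K : Type} [Field K] [NumberField K]
    (h : Nonempty (ReciprocityData K)) : ¬ RecRigidityAllClasses := by
  intro hrig
  obtain ⟨𝓡⟩ := h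
  obtain ⟨v⟩ := nonempty_heightOneSpectrum K
  obtain ⟨𝓡', hne, -, -⟩ := exists_reciprocityData_recGL_two_ne' 𝓡 v
  refine hne (funext fun c => ?_)
  induction c using IrrClass.ind with
  | h πv => exact (hrig K 𝓡 𝓡' 2 two_pos v πv).symm

/-- Packaging against the crux's first conjunct: `(∀ F, Nonempty (ReciprocityData F))` (which R
hands back, and which the line's `stub_nonempty_of_inputs` produces) refutes `RecRigidityAllClasses`.
[folklore] -/
theorem not_recRigidityAllClasses_of_forall_nonempty
    (hN : ∀ (F : Type) [Field F] [NumberField F], Nonempty (ReciprocityData F)) :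
    ¬ RecRigidityAllClasses :=
  not_recRigidityAllClasses_of_nonempty (hN ℚ)

end Global


/-! ### What this means for R and for the line -/

/-- **The crux itself refutes rigidity-on-all-classes**: R hands back `Nonempty (ReciprocityData ℚ)`,
and one datum has a pinned sibling with a different `rec₂`.  So `∀ Rec` in R genuinely ranges over
distinct data, and the line's rigidity stub is true ONLY because local components of cuspidal `π` are
generic (`CuspidalAutomorphicRepData.exists_isGeneric_of_hasLocalComponentAt`) and two six-clause
families agree on GENERIC classes (Henniart-type rigidity — crux 18745's lever, not in tree above the
supercuspidal floor). [folklore] -/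
theorem not_recRigidityAllClasses_of_R (hR : R) : ¬ RecRigidityAllClasses :=
  not_recRigidityAllClasses_of_forall_nonempty fun F _ _ => nonempty_of_R hR F

/-- **Targets / `stub_recRigidityLAlg` is false without `HasLocalComponentAt`** (any proof of the stub
must use its local-component hypothesis): verbatim `RecRigidityAllClasses` = the stub's conclusion for
every irreducible smooth `πv`, refuted from ONE reciprocity datum. [folklore] -/
theorem stub_recRigidityLAlg_false_without_hasLocalComponentAt {K : Type} [Field K] [NumberField K]
    (h : Nonempty (ReciprocityData K)) : ¬ RecRigidityAllClasses :=
  not_recRigidityAllClasses_of_nonempty h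

/-! ## §3 Hypothesis drops of R — why no `_false_without_` theorem is kernel-checkable here

Each mutation below is FALSE in print, but a proof of `¬` needs a witness object plus a NON-EXISTENCE
theorem the tree cannot supply; recorded as typed statements (no `sorry`, no claim) for the provers.

Junk on the automorphic side does not help either: the tree's junk kit
(`AutomorphicRepsGLLogDetCounterexample`: `W = span {log |det|_𝔸, 1} ⊋ W' = ℂ·1`, a cuspidal datum on
`GL₁` realising the trivial character NON-semisimply; used in the `n = 0` refutation of
`OrdinaryPrimeTransport.RankinSelbergPoleCount`) leaves the quotient `W / W'`, its Satake parameters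
(`{1}` everywhere) and its local components (the trivial character: `f(x) = x · log |·|` intertwines
modulo `W'`) unchanged, so (A′) for it is the consistent `π = 1 ↦ ρ = 1` run; on `GL_n`, `n ≥ 2`,
constants are not cusp forms and no clean cuspidal `V₀` exists in tree to twist by `log |det|`; and R
carries the guard `0 < n`, so the rank-0 trick of that refutation does not apply.
-/

/-- **R without `IsLAlgebraic`** (every cuspidal `π` has a geometric avatar).  False in print already
for `n = 1`, `F = ℚ`: a unitary Hecke character `|·|^{it}`, `t ≠ 0`, has no `ℓ`-adic avatar.  In-tree
refutation needs (i) a cuspidal GL(1) datum of non-algebraic type (constructible: BJ 4.6 dictionary,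
`exists_automorphicRepData_detTwist_glOne`) and (ii) the non-existence of a continuous
`ρ : Γ_ℚ → ℚ̄_ℓˣ` with `ρ(Frob_p) = ι⁻¹(p^{∓it})` a.e. — class field theory for `ℚ` (Kronecker–Weber)
plus an `ℓ`-adic-unit / transcendence argument about `ι⁻¹(p^{it})` for ALL `ι` at once; none in tree. -/
def RWithoutLAlgebraic : Prop :=
  ∀ (F : Type) [Field F] [NumberField F], Nonempty (ReciprocityData F) ∧ ∀ (Rec : ReciprocityData F) (n : ℕ), 0 < n → ∀ hcpt : Literature.NumberTheory.Automorphic.isCompact_glFiniteIntegralLevel n F, (∀ π : Literature.NumberTheory.Automorphic.CuspidalAutomorphicRepData n F hcpt, ∀ (ℓ : ℕ) [Fact ℓ.Prime] (ι : PadicAlgCl ℓ ≃+* ℂ), ∃ ρ : Literature.NumberTheory.GaloisRepresentations.FramedGaloisRep F (PadicAlgCl ℓ) n, IsGeometricFramed Rec ρ ∧ Corresponds Rec ι π.1 ρ) ∧ GaloisToAutomorphic n Rec hcpt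

/-- The mutation is weaker-hypothesis hence STRONGER: it implies R (bookkeeping only). [folklore] -/
theorem R_of_RWithoutLAlgebraic (h : RWithoutLAlgebraic) : R := fun F _ _ =>
  ⟨(h F).1, fun Rec n hn hcpt => ⟨fun π _ ℓ _ ι => ((h F).2 Rec n hn hcpt).1 π ℓ ι,
    ((h F).2 Rec n hn hcpt).2⟩⟩

/-- **(B) without `IsIrreducible`** (every geometric `ρ`, reducible or not, is CUSPIDAL automorphic).
False in print for `n = 2`, `F = ℚ`, `ρ = 1 ⊕ χ_cyc⁻¹` (Eisenstein).  In-tree refutation needs the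
cyclotomic character as a `FramedGaloisRep` (Mathlib has `cyclotomicCharacter`; continuity for the
Krull topology is not packaged), its de Rham-ness relative to the `Classical.epsilon`-pinned Fontaine
datum (decidable only for UNRAMIFIED-at-`ℓ` representations, clause F8 — `χ_cyc` is ramified at `ℓ`),
and "no cuspidal `π` on GL₂/ℚ has Satake parameters `{1, p⁻¹}` a.e." (Jacquet–Shalika bounds /
`PairLBoundaryJS`, an open INPUT item of this very route). -/
def GaloisToAutomorphicWithoutIrreducible : Prop :=
  ∀ (F : Type) [Field F] [NumberField F] (Rec : ReciprocityData F) (n : ℕ), 0 < n →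
    ∀ (hcpt : Literature.NumberTheory.Automorphic.isCompact_glFiniteIntegralLevel n F)
      (ℓ : ℕ) [Fact ℓ.Prime] (ι : PadicAlgCl ℓ ≃+* ℂ)
      (ρ : Literature.NumberTheory.GaloisRepresentations.FramedGaloisRep F (PadicAlgCl ℓ) n),
      IsGeometricFramed Rec ρ →
        ∃ π : Literature.NumberTheory.Automorphic.CuspidalAutomorphicRepData n F hcpt,
          π.1.IsLAlgebraic ∧ Corresponds Rec ι π.1 ρ

/-- **(B) without `IsGeometricFramed`** (every irreducible continuous `ρ` is automorphic).  False in
print for `n = 1`: a character of `Γ_F` of infinite order wildly ramified at `ℓ` that is not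
Hodge–Tate is not attached to an algebraic Hecke character.  In-tree refutation needs such a character
as a `FramedGaloisRep` (local class field theory at `ℓ` to build it) and the non-existence half
(`Corresponds` ⇒ `rec₁(π_v) = ρ|_{W_v}` at `v ∣ ℓ` through the ε-pinned `D_pst` datum ⇒ Hodge–Tate
weights) — both absent. -/
def GaloisToAutomorphicWithoutGeometric : Prop :=
  ∀ (F : Type) [Field F] [NumberField F] (Rec : ReciprocityData F) (n : ℕ), 0 < n →
    ∀ (hcpt : Literature.NumberTheory.Automorphic.isCompact_glFiniteIntegralLevel n F)
      (ℓ : ℕ) [Fact ℓ.Prime] (ι : PadicAlgCl ℓ ≃+* ℂ)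
      (ρ : Literature.NumberTheory.GaloisRepresentations.FramedGaloisRep F (PadicAlgCl ℓ) n),
      ρ.toGaloisRep.IsIrreducible →
        ∃ π : Literature.NumberTheory.Automorphic.CuspidalAutomorphicRepData n F hcpt,
          π.1.IsLAlgebraic ∧ Corresponds Rec ι π.1 ρ

/-- **R at `n = 0`** (the guard `0 < n` dropped).  Neither refutable nor provable in tree: every
clause at `n = 0` is about the trivial group (`IrrClass (GL (Fin 0) F)` and the rank-0 Weil–Deligne
classes are subsingletons, `IsLocalLanglandsGL.rec_zero_eq_recGLZero`), (B) is vacuous (a 0-dimensional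
representation is not irreducible: `IsSimpleOrder` needs `⊥ ≠ ⊤`), and (A′) reduces to the existence
of a geometric 0-dimensional `ρ`, i.e. to `IsDeRhamFramed` of the zero representation relative to the
`Classical.epsilon`-pinned Fontaine datum — undecidable until `FontaineDatumExists` / D2 land.  The
guard is Buzzard–Gee's (`n ≥ 1`); information only. -/
def RAtZero : Prop :=
  ∀ (F : Type) [Field F] [NumberField F] (Rec : ReciprocityData F)
    (hcpt : Literature.NumberTheory.Automorphic.isCompact_glFiniteIntegralLevel 0 F),
    (∀ π : Literature.NumberTheory.Automorphic.CuspidalAutomorphicRepData 0 F hcpt, π.1.IsLAlgebraic →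
      ∀ (ℓ : ℕ) [Fact ℓ.Prime] (ι : PadicAlgCl ℓ ≃+* ℂ),
        ∃ ρ : Literature.NumberTheory.GaloisRepresentations.FramedGaloisRep F (PadicAlgCl ℓ) 0,
          IsGeometricFramed Rec ρ ∧ Corresponds Rec ι π.1 ρ) ∧ GaloisToAutomorphic 0 Rec hcpt

/-! ## §4 Targets — the lead's stubs (line `Sketch`, skeleton 5096f204…), disprover's reading

* `stub_recRigidityLAlg` — TRUE in print (Henniart 1993 Thm 1.1 + Henniart 2002 Thm 1.6–1.8 on generic
  classes; local components generic); its hypothesis `HasLocalComponentAt` is LOAD-BEARING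
  (`stub_recRigidityLAlg_false_without_hasLocalComponentAt`, §2).  The relabelled data of §2 are the
  test any proof must survive: a proof that never invokes genericity of `πv` is wrong.
* `stub_exists_localEpsilonSystem_forall_isCanonical` — Deligne 1973 Thm 4.1 with the Artin maps of
  class field theory; as typed it quantifies over every `E` with ARBITRARY local-field instances and
  `[Algebra F E] [FiniteDimensional F E]` (no `IsScalarTower`/continuity of the structure map); each
  such `E` only asks `(𝓔.artin E).IsCanonical` separately, and `IsCanonical` refers to `E`'s own
  pinned map, so exotic instances impose no cross-constraint visible at this level — no cheap kill.
* `stub_localLanglands_gl` — the named fact verbatim; over-general in the Artin datum `d` (its own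
  docstring, Note (2)); harmless for the line, which instantiates it at the canonical pair only.  A
  refuter wanting to attack it must build an exotic `LocalEpsilonSystem` — out of reach.
* `stub_nonempty_of_inputs` — glue; `stub_E` = 14328 (open problem; `E_of_R`).
* `stub_rigid_of_reciprocityUpToIrreducibilityR` (`JS(2.2) → JS(2.3) → R → rigidity on local
  components`): consistent with §2 (the sibling data differ only OFF local components).
-/

end Summit.Langlands.Langlands.Cruxes.ReciprocityUpToIrreducibilityR.Disproof

end
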